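import Mathlib
import Summits.Ventures.PercRepro2.TwoHullMasterPendant
import Summits.Ventures.PercRepro2.TwoHullMasterPath2

/-!
# A path is pendant-compatible (blind cell PercRepro2, night-4 g39, 2026-08-29;
proofs/NIGHT4-G39.md §7, Theorem 5)

The interface involution of a path satisfies `PendantOK` (TwoHullMasterPendant.lean): with a red
first edge the red suffix run avoids the hull of `l` (else the word is constant) and the blue
suffix run of the flipped word avoids it (the flipped mismatch edge is red), symmetrically for a
blue first edge, and the core of `l` is `{l}` (`pendantOK_path`).  Hence, by
`sideInvolution_pendant` / `pendantOK_pendant` applied at each inner vertex, every DECORATED path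
(arbitrary graphs hanging at its inner vertices) carries a side involution, and (MM) holds on every
theta graph of decorated paths with arbitrary graphs at `l` and `h`.
-/

namespace Summit.Ventures.PercRepro2

namespace Path2

open Hull LocRows Glue Glue2

open scoped Classical

variable {V : Type*} {k : ℕ} {p : Fin (k + 1) → V}

/-- A word with a red prefix run up to `v` and a red suffix run from `v` is constant. -/
lemma isConst_of_pre_suf {ζ : Config (Fin k)} {b : Bool} {v : Fin (k + 1)} (hpre : Pre ζ b v)
    (hsuf : Suf ζ b v) : IsConst ζ := by
  intro a a'
  have ha : ζ a = b := by
    by_cases h : (a : ℕ) < v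
    · exact hpre a h
    · exact hsuf a (not_lt.1 h)
  have ha' : ζ a' = b := by
    by_cases h : (a' : ℕ) < v
    · exact hpre a' h
    · exact hsuf a' (not_lt.1 h)
  rw [ha, ha']

/-- **A path is pendant-compatible.** -/
theorem pendantOK_path (hp : Function.Injective p) :
    PendantOK (pathEnds p) (p 0) (p (Fin.last k)) flipHead headColour where
  red_avoid ζ hU hc x hx hx' := by
    rw [last_notMem_hull_iff hp] at hU
    obtain ⟨r, hr, j₀, hj₀, hne⟩ := exists_first_mismatch hU
    have hk : 0 < k := lt_of_le_of_lt (Nat.zero_le _) r.isLt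
    have hcol := headColour_eq hr hj₀ hne
    rw [hc] at hcol
    have hζr : ζ r = false := by
      cases h1 : ζ r with
      | false => rfl
      | true => rw [h1] at hcol; simp at hcol
    rw [mem_cluster_last_iff hp] at hx'
    obtain ⟨v, rfl, hsuf⟩ := hx'
    rw [mem_hull_iff, mem_cluster_zero_iff hp, mem_cluster_zero_iff hp] at hx
    rcases hx with ⟨v', hv', hpre⟩ | ⟨v', hv', hpre⟩
    · rw [← hp hv'] at hpre
      exact hU (isConst_of_pre_suf hpre hsuf)
    · rw [← hp hv'] at hpre
      rw [RedPrefix_iff_Pre, Pre_blue_iff] at hpre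
      by_cases hv0 : (v : ℕ) = 0
      · apply hU
        apply isConst_of_pre_suf (b := true) (v := v) (fun i hi => by omega) hsuf
      · have h0 := hpre ⟨0, hk⟩ (by show (0 : ℕ) < (v : ℕ); omega)
        have h0r : (⟨0, hk⟩ : Fin k) < r := Fin.lt_def.2 (by have := Fin.lt_def.1 hj₀; simp; omega)
        rw [eq_not_of_lt hr hj₀ hne h0r, hζr] at h0
        simp at h0
  blue_avoid' ζ hU hc x hx hx' := by
    rw [last_notMem_hull_iff hp] at hU
    obtain ⟨r, hr, j₀, hj₀, hne⟩ := exists_first_mismatch hU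
    have hk : 0 < k := lt_of_le_of_lt (Nat.zero_le _) r.isLt
    have hcol := headColour_eq hr hj₀ hne
    rw [hc] at hcol
    have hζr : ζ r = false := by
      cases h1 : ζ r with
      | false => rfl
      | true => rw [h1] at hcol; simp at hcol
    rw [mem_cluster_last_iff hp] at hx'
    obtain ⟨v, rfl, hsuf⟩ := hx'
    rw [RedSuffix_iff_Suf, Suf_blue_iff] at hsuf
    rw [mem_hull_iff, mem_cluster_zero_iff hp, mem_cluster_zero_iff hp] at hx
    rcases hx with ⟨v', hv', hpre⟩ | ⟨v', hv', hpre⟩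
    · rw [← hp hv'] at hpre
      -- the red prefix ends at or before `r`; the flipped edge `r` is red
      have hvr : (v : ℕ) ≤ r := by
        by_contra hlt
        have := hpre r (by omega)
        rw [hζr] at this; simp at this
      have := hsuf r hvr
      rw [flipHead_apply_le hr hj₀ hne le_rfl, hζr] at this
      simp at this
    · rw [← hp hv'] at hpre
      rw [RedPrefix_iff_Pre, Pre_blue_iff] at hpre
      by_cases hv0 : (v : ℕ) = 0
      · apply not_isConst_flipHead hU
        exact isConst_of_pre_suf (b := false) (v := v) (fun i hi => by omega) hsuf
      · have h0 := hpre ⟨0, hk⟩ (by show (0 : ℕ) < (v : ℕ); omega)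
        have h0r : (⟨0, hk⟩ : Fin k) < r := Fin.lt_def.2 (by have := Fin.lt_def.1 hj₀; simp; omega)
        rw [eq_not_of_lt hr hj₀ hne h0r, hζr] at h0
        simp at h0
  blue_avoid ζ hU hc x hx hx' := by
    rw [last_notMem_hull_iff hp] at hU
    obtain ⟨r, hr, j₀, hj₀, hne⟩ := exists_first_mismatch hU
    have hk : 0 < k := lt_of_le_of_lt (Nat.zero_le _) r.isLt
    have hcol := headColour_eq hr hj₀ hne
    rw [hc] at hcol
    have hζr : ζ r = true := by
      cases h1 : ζ r with
      | true => rfl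
      | false => rw [h1] at hcol; simp at hcol
    rw [mem_cluster_last_iff hp] at hx'
    obtain ⟨v, rfl, hsuf⟩ := hx'
    rw [RedSuffix_iff_Suf, Suf_blue_iff] at hsuf
    rw [mem_hull_iff, mem_cluster_zero_iff hp, mem_cluster_zero_iff hp] at hx
    rcases hx with ⟨v', hv', hpre⟩ | ⟨v', hv', hpre⟩
    · rw [← hp hv'] at hpre
      by_cases hv0 : (v : ℕ) = 0
      · apply hU
        exact isConst_of_pre_suf (b := false) (v := v) (fun i hi => by omega) hsuf
      · have h0 := hpre ⟨0, hk⟩ (by show (0 : ℕ) < (v : ℕ); omega)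
        have h0r : (⟨0, hk⟩ : Fin k) < r := Fin.lt_def.2 (by have := Fin.lt_def.1 hj₀; simp; omega)
        rw [eq_not_of_lt hr hj₀ hne h0r, hζr] at h0
        simp at h0
    · rw [← hp hv'] at hpre
      rw [RedPrefix_iff_Pre, Pre_blue_iff] at hpre
      exact hU (isConst_of_pre_suf hpre hsuf)
  red_avoid' ζ hU hc x hx hx' := by
    rw [last_notMem_hull_iff hp] at hU
    obtain ⟨r, hr, j₀, hj₀, hne⟩ := exists_first_mismatch hU
    have hk : 0 < k := lt_of_le_of_lt (Nat.zero_le _) r.isLt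
    have hcol := headColour_eq hr hj₀ hne
    rw [hc] at hcol
    have hζr : ζ r = true := by
      cases h1 : ζ r with
      | true => rfl
      | false => rw [h1] at hcol; simp at hcol
    rw [mem_cluster_last_iff hp] at hx'
    obtain ⟨v, rfl, hsuf⟩ := hx'
    rw [RedSuffix_iff_Suf] at hsuf
    rw [mem_hull_iff, mem_cluster_zero_iff hp, mem_cluster_zero_iff hp] at hx
    rcases hx with ⟨v', hv', hpre⟩ | ⟨v', hv', hpre⟩
    · rw [← hp hv'] at hpre
      by_cases hv0 : (v : ℕ) = 0
      · apply not_isConst_flipHead hU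
        exact isConst_of_pre_suf (b := true) (v := v) (fun i hi => by omega) hsuf
      · have h0 := hpre ⟨0, hk⟩ (by show (0 : ℕ) < (v : ℕ); omega)
        have h0r : (⟨0, hk⟩ : Fin k) < r := Fin.lt_def.2 (by have := Fin.lt_def.1 hj₀; simp; omega)
        rw [eq_not_of_lt hr hj₀ hne h0r, hζr] at h0
        simp at h0
    · rw [← hp hv'] at hpre
      rw [RedPrefix_iff_Pre, Pre_blue_iff] at hpre
      have hvr : (v : ℕ) ≤ r := by
        by_contra hlt
        have := hpre r (by omega)
        rw [hζr] at this; simp at this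
      have := hsuf r hvr
      rw [flipHead_apply_le hr hj₀ hne le_rfl, hζr] at this
      simp at this
  core ζ hU x hx hx' := by
    rw [mem_cluster_zero_iff hp] at hx hx'
    obtain ⟨v, rfl, hpre⟩ := hx
    obtain ⟨v', hv', hpre'⟩ := hx'
    rw [← hp hv'] at hpre'
    rw [RedPrefix_iff_Pre, Pre_blue_iff] at hpre'
    by_cases hv0 : (v : ℕ) = 0
    · congr 1; exact Fin.ext hv0
    · exfalso
      have hk : 0 < k := by
        by_contra h0
        have : (v : ℕ) < k + 1 := v.isLt
        omega
      have h1 := hpre ⟨0, hk⟩ (by show (0 : ℕ) < (v : ℕ); omega)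
      have h2 := hpre' ⟨0, hk⟩ (by show (0 : ℕ) < (v : ℕ); omega)
      rw [h1] at h2; simp at h2

end Path2


end Summit.Ventures.PercRepro2
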